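import Summits.QuantumFields.YangMills.Theorems.BalabanUVNodesN07SmallActionBoundaryAvoidance
import Literature.MathematicalPhysics.QuantumFieldTheory.Balaban1983to89.BlockAveragingPlaquetteBound
import HarnessLib

/-!
# BalabanUVNodes ∕ N07 ([Balaban1985Variational] Theorem 1, hypothesis (7) p. 278 and conclusion (8) p. 279, in node00-def-P11's RE-TYPED reading
# `Node00.VariationalThm1RegSepMixed` at the objects of record) — THE CORNER-AT-LEVEL-0 OBSTRUCTION: the level-0 clause of the typed data hypothesis
# `Sect2.DataSmall7` ranges over the plaquettes INSIDE `Γ₀ = Ω₁ᶜ`, but the fibre pins every fine plaquette whose four BONDS meet `Γ₀` — in particular the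
# plaquettes with one corner in `Ω₁`; the regularity sentence (R) is demanded at scale 0 on ALL plaquettes at the threshold `B₃δ₀`, with `δ₀` free from below;
# so `VariationalThm1RegSepMixed F N B₃ a₀ a₁` is FALSE FOR EVERY `B₃` (`0 < a₀`, `0 < a₁`; `SU(2)`, or any `SU(N)` on which `dist1` is onto `[0, 2]`).
# On the way: SMALL-ACTION BOUNDARY AVOIDANCE — the (2.12) variational problem over the OPEN multi-scale class HAS a minimiser whenever its fibre holds an
# element of the open class with Wilson action below one boundary plaquette (PROVED at NODE 00's objects; the existence sentence of Thm 1 in that regime).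

HEADLINE.  Work toward ONE FINITE-LATTICE STEP of Bałaban's programme — the typed RANGE of [15] Thm 1 at NODE 00's objects (cell `pub-ymgap`, Track A, DAG
node **N07** = [15] = [Balaban1985Variational]; seat `pub-ymgap-dag-n07-e`, generation 7, INTENT-19 INBOX l.17307; director-ym №142 (S2) HYP-AUDIT-13 witness
«H8∕H6 — the level-0 range»; `--kind proof --supports stmt-QuantumFields-20289 --as helper`, the ROW-P11 negative lane).  THEOREMS ONLY (0 `def`, 0 `sorry`,
0 `instance`).  Companions: 17a `…N07Thm1ScaledInterfaceInstance` (corner plaquette, one-step index, single-bond data, the pin), 13 `…N07DirectMethodDetSet`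
(the direct method over closed classes), 18 `…N07Thm1MixedPlaquetteObstruction` (the mixed-plaquette certificate against the OLD facts — a different datum).

PRINT ([15] pp. 277–279, held text `paper:balaban1985-cmp102-variational-background` p0001–p0003, quoted by node00-def-P11 INBOX l.17052∕l.17230 and dag-ref-G
l.17245).  p. 277 L25–27: sets of bonds «with at least one end-point» ∕ plaquettes «with at least one corner» in a site set.  p. 278 (7): «|(∂V)(p′) − 1| < ε₁
for p′ ∈ 𝔅 … For some j between 0 and k, p′ ∈ Λ_j. If p′ ⊂ Λ_j, i.e. all four vertices of p′ belong to Λ_j, then … (∂V)(p′) = V(∂p′). If p′ intersects the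
boundary of Λ_j then some bonds b do not belong to Λ_j and we replace V_b by V̄_b».  p. 279 Thm 1 (8): the minimal orbit lies in `U_k({Ω_j}, B₃ε₁)`, `Ω₀ = T_η`.

THE TYPED READING UNDER TEST (`Node00/Record12BgRowMixed.lean`, p504801).  `Sect2.DataSmall7 av Ω k δ W` := level 0: `PlaqSmallOn (plaqInside (genSet Ω k 0))
(δ 0) (W 0)` — plaquettes with ALL FOUR CORNERS in `Γ₀`; level `m+1 ≤ k`: the plaquettes TOUCHING `Γ_{m+1}` in the mixed field.  `VariationalThm1RegSepMixed F N
B₃ a₀ a₁` := for separated (2.18) indices, thresholds `0 < δ_n ≤ a₁`, `B₃δ_n ≤ ε₀ ≤ a₀`, `δ_n ≤ 2δ_{n+1}`, data with `DataSmall7 … δ W`, EVERY (2.12) minimiser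
over the class `{∀ n ≤ k, PlaqSmallOn (omegaPlaqs s.Ω n) (ε₀η_n²)}` on the fibre of `W` satisfies `PlaqSmallOn (omegaPlaqs s.Ω n) (B₃δ_nη_n²)` for all `n ≤ k` —
and `omegaPlaqs s.Ω 0 = Set.univ` ([6] (1.3) `Ω₀ = T_η`).

THE MECHANISM (M3).  (1) THE UNREAD PINNED PLAQUETTE: the fibre `AgreeOn (genSet s.Ω k) (avgFamily av U) W` pins `U = W 0` on `bondsOf Γ₀` (bonds with ≥ 1
end in `Γ₀`), hence pins `U(∂p)` for every fine plaquette all of whose four bonds meet `Γ₀` — e.g. a plaquette with exactly one corner in `Ω₁` (17a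
`exists_cornerPlaq`, `plaqHol_eq_of_agreeOn`) — which is NOT in `plaqInside Γ₀` and is not a coarse plaquette: read by NO clause of `DataSmall7`.  In print such a
`p′` has NO bond «not belonging to Λ₀», so (7)'s first formula `(∂V)(p′) = V(∂p′)` applies to it: it IS in (7)'s range.  (2) THE FREE THRESHOLD: (R) at `n = 0`
reads ALL plaquettes at `B₃δ₀η₀² = B₃δ₀`, and `δ₀` is bounded only from above.  (3) THE DATUM (torus `F.P 1`, `k = 1`, `s.Ω 1 = D = cubeEnl P L 0 0`): `U₁ ≡ 1`
except ONE fine bond `⟨x + e_{μ₁}, μ₀⟩` entering `D` at the far corner `x + e_{μ₀} + e_{μ₁} ∈ D` of the corner plaquette `p = ⟨x; μ₀, μ₁⟩`, carrying `h` with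
`dist1 h = t`; `W := avgFamily (avOfRecord F N 1) U₁` at ALL scales, so `U₁` lies in the fibre of `W` by `rfl`.  `DataSmall7 … δ W` holds for EVERY `δ₀ > 0`
(a plaquette inside `Γ₀` has every bond-target in `Γ₀`, so `U₁ = 1` on it) and every `δ₁ ≥ 2(L² + 6((d+2)L)²)·t` (the level-1 mixed field is `Ū₁` on every
coarse bond; `BlockAveragingPlaquetteBound.dist1_plaqHol_avgFun_lt`).  (4) EXISTENCE of an OPEN-class minimiser: §1's small-action boundary avoidance
(`A(U₁) ≤ #Plaq·t² `, `2N·A < (ε₀η₁²)²`).  (5) THE VIOLATION: every minimiser `U₀` has `U₀(∂p) = U₁(∂p) = h⁻¹`, `dist1 = t`, while (R) at `n = 0` demands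
`< B₃δ₀ ≤ t∕2` for `δ₀ := min(δ₁, t∕(2·max(B₃,1)))`.

CONTENTS.  The generic steps live in the companion `…N07SmallActionBoundaryAvoidance` (same seat, same INTENT; split for the 400-line rail): §1 there =
small-action boundary avoidance (★★ `exists_isMinimizer_holes_of_smallAction`: ∃ a (2.12) minimiser over the OPEN multi-scale class ⟸ a fibre element in the
open class with `2N·A < (ε₀η_k²)²`, module 13's direct method + `B8Eq110UnitaryProof.cmp∕cmp'_specialUnitaryGroup`); §2 there = the single-bond datum against
`plaqInside`, the corner plaquette, `mixedField_avg_self`, `cornerPlaq_bonds_mem_bondsOf` (the print-exact level-0 range READS `p`),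
`outerPlaqs_zero_subset_plaqInside` (FILE 8 v1.2's «outer» range is `plaqInside Γ₀` again at level 0).  HERE (§3): ★★ `exists_cornerLevelZero_instance`,
★★★ `not_variationalThm1RegSepMixed_of_dist1Surj`, ★★★ `not_variationalThm1RegSepOuter_of_dist1Surj`, ★★★ `not_variationalThm1RegSepMixed` and
★★★ `not_variationalThm1RegSepOuter` (`SU(2)`, every `B₃`), `variationalThm1RegSepMixed_only_degenerate`.

WHAT THIS SAYS ∕ DOES NOT SAY (HONEST FRAMING).  (i) The RE-TYPED named facts of record `VariationalThm1RegSepMixed` (v1.0) and `VariationalThm1RegSepOuter` (v1.2)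
are UNINHABITED at every `B₃` once `a₀, a₁ > 0` (at `N = 2`); their `h15`-keyed suppliers (`plaqSmallOn_UbgMSOfRecord_of_thm1RegSep{Mixed,Outer}`,
`bgRowAtDatum_of_thm1RegSep{Mixed,MixedC1,OuterC1}`) are vacuous as typed.  The v1.3 fact `VariationalThm1RegSepPrinted` (p507636, level 0 over the plaquettes
whose four bonds lie in `bondsOf Γ₀`) is NOT touched: it READS the corner plaquette (§2 `cornerPlaq_bonds_mem_bondsOf`), so this datum needs `t < δ₀ ≤ B₃δ₀` there.
LOCATED FIRST on the bus by dag-ref-C g26 (LOCATED-P11-LEVEL0, INBOX l.17306, by hand, same datum) and independently by this seat ((M3), l.17307, with the existence step);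
this file is the kernel certificate.  The located repair
(the definers' — node00-def-P11 FILE 8 v1.3 `Sect2.DataSmall7P`, dag-ref-G's `plaqNoBondIn`): the level-0 clause of (7) must read every fine plaquette whose four
bonds lie in `bondsOf Γ₀` (print-exact), or `plaqsOf Γ₀`.  (ii) NOT hit, honestly: the UNIFORM
instance `δ_n := ε₁` (print's single threshold), plan v7's `stub_bgClassBound13` and node00-def-K0a's class-bound currency over `suppOfRecord₁₃[Sep]` (whose
same-scale level-0 clause reads `plaqsOf Γ₀`).  (iii) NOTHING of [15] Theorem 1 AS PRINTED is refuted or asserted: print's (7) READS the corner plaquette.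
(iv) §1's existence theorem is a kernel theorem about the tree's own objects (compactness + continuity + one action comparison), volume-dependent through
`#Plaq`, NOT Bałaban's uniform existence statement.  (v) Count-neutral; N07 ∕ K0⁗ NOT discharged; one finite `𝕋⁴` programme at fixed `ε = L^{−K}` — NOT
continuum ∕ ℝ⁴ ∕ OS ∕ mass gap ∕ Clay.  No `instance`, no notation, 0 kit.

DEPENDENCES (by name, nothing modified): companion `…N07SmallActionBoundaryAvoidance` (§1–§2); 17a (`exists_cornerPlaq`, `exists_seqOfRecord_one`, `RkOfRecord_zero_r`, `su2_dist1_surj`, `dist1_plaqHol_single_le`,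
`plaqHol_eq_of_agreeOn`, `eta_one_sq`); 13 (`exists_isMinimizer_of_isClosed`, `isMinimizer_of_isMinimizer_closure_of_mem`); 11a (`closure_plaqSmall_subset_plaqSmall`);
`BlockAveragingPlaquetteBound.dist1_plaqHol_avgFun_lt`; `B8Eq110UnitaryProof.cmp_specialUnitaryGroup ∕ cmp'_specialUnitaryGroup`; `ExpMeanLog.deltaSU_pos`;
`Node00.avOfRecord_avg`; node00-def-P11's `Sect2.DataSmall7`, `Sect2.mixedField`, `VariationalThm1RegSepMixed`; r12 `B15DeterminingSets`; `T4WilsonLinkAffine.shift_ne_self`.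
-/

noncomputable section

namespace Summit.QuantumFields.YangMills.BalabanUVNodes.N07Thm1CornerLevelZeroObstruction

open Set
open Literature.MathematicalPhysics.QuantumFieldTheory.Balaban1983to89
open Literature.MathematicalPhysics.QuantumFieldTheory.Balaban1983to89.T4Continuum (T4Family)
open Literature.MathematicalPhysics.QuantumFieldTheory.Balaban1983to89.Node00
open Literature.MathematicalPhysics.QuantumFieldTheory.Balaban1983to89.B15DeterminingSets
open Summit.QuantumFields.YangMills.BalabanUVNodes.N07Thm1ScaledInterfaceInstance
open BlockAveraging (avgFun)
open BlockAveragingPlaquetteBound (dist1_plaqHol_avgFun_lt)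
open ExpMeanLog (expMeanLogSU deltaSU deltaSU_pos)
open Summit.QuantumFields.YangMills.BalabanUVNodes.N07SmallActionBoundaryAvoidance
open scoped Matrix.Norms.L2Operator

/-! ## §3  ★★ The corner-at-level-0 instance of record and ★★★ the refutations at every `B₃` (§1–§2: companion `…N07SmallActionBoundaryAvoidance`) -/

section Refutation

variable (F : T4Family) {N : ℕ} [NeZero N]

/-- ★★ **THE INSTANCE OF RECORD** (torus `F.P 1`, `k = 1`): for every `B₃` and all `a₀, a₁ > 0` — given that `dist1` is onto `[0, 2]` on `SU(N)` — a (vacuously)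
separated one-step index `s` (`Ω₁ =` the `L`-cube of index `0`), thresholds `δ` meeting EVERY binder of `VariationalThm1RegSepMixed` (`0 < δ_n ≤ a₁`,
`B₃δ_n ≤ ε₀ ≤ a₀`, `δ₀ ≤ 2δ₁`), a datum `W` satisfying the TYPED (7) `Sect2.DataSmall7 … δ W`, such that a (2.12) minimiser over the open `ε₀`-class EXISTS
(§1) and EVERY such minimiser violates (R) at scale `0` on the corner plaquette `p` (`B₃δ₀η₀² ≤ |U₀(∂p) − 1|`, and `p ∈ omegaPlaqs s.Ω 0 = univ`).
[cite: Balaban1985Variational, Thm 1 (7)–(8) pp.278–279; Balaban1988Convergent, (2.10)–(2.12) p.256] -/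
theorem exists_cornerLevelZero_instance (hG : ∀ t : ℝ, 0 ≤ t → t ≤ 2 → ∃ g : SU N, dist1 g = t) (B₃ : ℝ) {a₀ a₁ : ℝ}
    (ha₀ : 0 < a₀) (ha₁ : 0 < a₁) :
    ∃ (ν : Stage7Numerics) (M : ℕ) (g : ℕ → ℝ) (s : SeqOfRecord F ν M g 1 1) (ε₀ : ℝ) (δ : ℕ → ℝ) (W : MSField (F.P 1) (SU N))
      (p : Plaq (F.P 1) 0),
      Sect2.SeqSeparated ν.M₁ s ∧ (∀ n, n ≤ 1 → 0 < δ n ∧ δ n ≤ a₁ ∧ B₃ * δ n ≤ ε₀) ∧ (∀ n, n < 1 → δ n ≤ 2 * δ (n + 1)) ∧ ε₀ ≤ a₀ ∧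
      Sect2.DataSmall7 (avOfRecord F N 1) s.Ω 1 δ W ∧ Sect2.DataSmall7Outer (avOfRecord F N 1) s.Ω 1 δ W ∧
      (∃ U₀, IsMinimizer (avOfRecord F N 1) {U | ∀ n, n ≤ 1 → PlaqSmallOn (omegaPlaqs s.Ω n) (ε₀ * (F.P 1).eta n ^ 2) U} (genSet s.Ω 1) W U₀) ∧
      p ∈ omegaPlaqs s.Ω 0 ∧
      ∀ U₀, IsMinimizer (avOfRecord F N 1) {U | ∀ n, n ≤ 1 → PlaqSmallOn (omegaPlaqs s.Ω n) (ε₀ * (F.P 1).eta n ^ 2) U} (genSet s.Ω 1) W U₀ →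
        B₃ * δ 0 * (F.P 1).eta 0 ^ 2 ≤ dist1 (GaugeField.plaqHol U₀ p) := by
  -- the one-step index of companion 17a: `r = 0`, `M = 1`, `g ≡ 1`, side `L`
  let ν : Stage7Numerics := ⟨1, 1, 0, 0, 0, 0, 0, 0⟩
  have hside : dCubeSide (F.P 1).L 1 (RkOfRecord (F.P 1).L ν.r ((fun _ : ℕ => (1 : ℝ)) 1)) 1 = (F.P 1).L := by
    simp [dCubeSide, RkOfRecord_zero_r, ν]
  have hL1 : 1 ≤ (F.P 1).L := by rw [T4Family.P_L]; have := F.hL.2; omega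
  obtain ⟨s, hsΩ⟩ := exists_seqOfRecord_one F ν 1 (fun _ => (1 : ℝ)) 1 (by rw [hside]; exact hL1)
  rw [hside] at hsΩ
  -- torus bookkeeping
  have hd : (F.P 1).d = 4 := T4Family.P_d F 1
  have hL1' : 1 ≤ F.L := by have := F.hL.2; omega
  have hK : 0 + 1 ≤ (F.P 1).m + (F.P 1).K := by have := F.hm; simp only [T4Family.P_m, T4Family.P_K]; omega
  have hLn : (F.P 1).L < (F.P 1).sitesPerDir 0 := by
    have h1 : F.L ≤ F.L ^ (F.m + 1) := Nat.le_self_pow (by have := F.hm; omega) F.L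
    have h2 : (F.P 1).sitesPerDir 0 = 2 * F.L ^ (F.m + 1) := by simp [Params.sitesPerDir]
    rw [h2, T4Family.P_L]; omega
  have hLnZ : (((F.P 1).L : ℕ) : ℤ) < (F.P 1).sitesPerDir 0 := by exact_mod_cast hLn
  have hLpos : (0 : ℝ) < (F.P 1).L := by exact_mod_cast (show 0 < (F.P 1).L by omega)
  have hL2pos : (0 : ℝ) < ((F.P 1).L : ℝ) ^ 2 := pow_pos hLpos 2
  -- the corner plaquette of `D = cubeEnl P L 0 0` (far corner in `D`, three near corners off `D`, `p.μ` the least direction)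
  obtain ⟨p, hp1, hp2, hp3, hp4, hp5⟩ := exists_cornerPlaq (P := F.P 1) hL1 hLnZ (by omega)
  set D : Set (Site (F.P 1) 0) := cubeEnl (F.P 1) (F.P 1).L 0 0 with hD
  -- the twisted bond `⟨x′, μ₀⟩ := ⟨p.src + e_{p.ν}, p.μ⟩` ENTERS `D`
  have hxD : (p.src.shift p.ν).shift p.μ ∈ D := by rw [← Site.shift_comm]; exact hp1
  -- thresholds and radii
  have hδSU := deltaSU_pos (n := Fin N)
  set α₀ : ℝ := min (1 / 109824) (deltaSU (Fin N) / (64 * ((F.P 1).L : ℝ) ^ 2)) with hα₀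
  have hα₀pos : 0 < α₀ := lt_min (by norm_num) (div_pos hδSU (mul_pos (by norm_num) hL2pos))
  have hα₀1 : α₀ ≤ 1 / 109824 := min_le_left _ _
  have hα₀2 : α₀ ≤ deltaSU (Fin N) / (64 * ((F.P 1).L : ℝ) ^ 2) := min_le_right _ _
  have hα3 : (143 * (((((F.P 1).d + 4 : ℕ) : ℝ)) ^ 2 / 4) ^ 2) * α₀ ≤ 1 / 3 := by
    have : (((((F.P 1).d + 4 : ℕ) : ℝ)) ^ 2 / 4) ^ 2 = 256 := by rw [hd]; norm_num
    rw [this]; linarith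
  have hα2 : 2 * α₀ ≤ 2 * deltaSU (Fin N) / ((((F.P 1).d + 4) * (F.P 1).L : ℕ) : ℝ) ^ 2 := by
    have : ((((F.P 1).d + 4) * (F.P 1).L : ℕ) : ℝ) ^ 2 = 64 * ((F.P 1).L : ℝ) ^ 2 := by rw [hd]; push_cast; ring
    rw [this]
    calc 2 * α₀ ≤ 2 * (deltaSU (Fin N) / (64 * ((F.P 1).L : ℝ) ^ 2)) := by linarith
      _ = 2 * deltaSU (Fin N) / (64 * ((F.P 1).L : ℝ) ^ 2) := by ring
  set ε₀ : ℝ := min a₀ (α₀ / (2 * ((F.P 1).L : ℝ) ^ 2)) with hε₀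
  have hε₀pos : 0 < ε₀ := lt_min ha₀ (div_pos hα₀pos (mul_pos two_pos hL2pos))
  have hε₀a₀ : ε₀ ≤ a₀ := min_le_left _ _
  have hη1 : (F.P 1).eta 1 ^ 2 = 1 / ((F.P 1).L : ℝ) ^ 2 := by rw [eta_one_sq, T4Family.P_L]
  have hεα : ε₀ < α₀ * (F.P 1).eta 1 ^ 2 := by
    rw [hη1]
    have h1 : ε₀ ≤ α₀ / (2 * ((F.P 1).L : ℝ) ^ 2) := min_le_right _ _
    have h2 : α₀ / (2 * ((F.P 1).L : ℝ) ^ 2) < α₀ * (1 / ((F.P 1).L : ℝ) ^ 2) := by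
      rw [mul_one_div, div_lt_div_iff_of_pos_left hα₀pos (mul_pos two_pos hL2pos) hL2pos]
      linarith
    exact h1.trans_lt h2
  set e₁ : ℝ := ε₀ * (F.P 1).eta 1 ^ 2 with he₁
  have he₁pos : 0 < e₁ := mul_pos hε₀pos (by rw [hη1]; exact div_pos one_pos hL2pos)
  set b : ℝ := max B₃ 1 with hb
  have hb1 : 1 ≤ b := le_max_right _ _
  have hbB : B₃ ≤ b := le_max_left _ _
  have hb0 : 0 < b := by linarith
  set δ₁ : ℝ := min a₁ (ε₀ / b) with hδ₁
  have hδ₁pos : 0 < δ₁ := lt_min ha₁ (div_pos hε₀pos hb0)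
  have hδ₁a : δ₁ ≤ a₁ := min_le_left _ _
  have hBδ₁ : B₃ * δ₁ ≤ ε₀ :=
    calc B₃ * δ₁ ≤ b * δ₁ := mul_le_mul_of_nonneg_right hbB hδ₁pos.le
      _ ≤ b * (ε₀ / b) := mul_le_mul_of_nonneg_left (min_le_right _ _) hb0.le
      _ = ε₀ := by field_simp
  -- the averaging constant, the plaquette count, the twist size `t`
  set C : ℝ := ((F.P 1).L : ℝ) ^ 2 + 6 * ((((F.P 1).d + 2) * (F.P 1).L : ℕ) : ℝ) ^ 2 with hC
  have hCpos : 0 < C := by rw [hC]; exact add_pos_of_pos_of_nonneg hL2pos (by positivity)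
  set cP : ℝ := (Fintype.card (Plaq (F.P 1) 0) : ℝ) with hcP
  have hcP0 : 0 ≤ cP := Nat.cast_nonneg _
  set Mb : ℝ := 2 * N * cP + 1 with hMb
  have hNcP : (0 : ℝ) ≤ 2 * N * cP := mul_nonneg (mul_nonneg zero_le_two (Nat.cast_nonneg N)) hcP0
  have hMb1 : 1 ≤ Mb := by rw [hMb]; linarith
  have hMbpos : 0 < Mb := by linarith
  set t : ℝ := min 1 (min (δ₁ / (2 * C + 1)) (min (e₁ / (2 * Mb)) (deltaSU (Fin N) / (36 * ((F.P 1).L : ℝ) ^ 2 + 1)))) with ht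
  have ht0 : 0 < t := lt_min one_pos (lt_min (div_pos hδ₁pos (by linarith))
    (lt_min (div_pos he₁pos (by linarith)) (div_pos hδSU (by linarith))))
  have ht1 : t ≤ 1 := min_le_left _ _
  have htδ : t ≤ δ₁ / (2 * C + 1) := (min_le_right _ _).trans (min_le_left _ _)
  have hte : t ≤ e₁ / (2 * Mb) := (min_le_right _ _).trans ((min_le_right _ _).trans (min_le_left _ _))
  have htS : t ≤ deltaSU (Fin N) / (36 * ((F.P 1).L : ℝ) ^ 2 + 1) :=
    (min_le_right _ _).trans ((min_le_right _ _).trans (min_le_right _ _))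
  have hCt : C * (2 * t) ≤ δ₁ := by
    have h := (le_div_iff₀ (by linarith : (0 : ℝ) < 2 * C + 1)).mp htδ
    calc C * (2 * t) = t * (2 * C) := by ring
      _ ≤ t * (2 * C + 1) := mul_le_mul_of_nonneg_left (by linarith) ht0.le
      _ ≤ δ₁ := h
  have htMb : t * (2 * Mb) ≤ e₁ := (le_div_iff₀ (by linarith)).mp hte
  have hMt : Mb * t ≤ e₁ / 2 := by
    have : t * (2 * Mb) = 2 * (Mb * t) := by ring
    rw [this] at htMb; linarith
  have hte1 : t < e₁ := by
    have h2 : t ≤ Mb * t := le_mul_of_one_le_left ht0.le hMb1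
    linarith
  -- the twist and the single-bond datum
  obtain ⟨h, hh⟩ := hG t ht0.le (ht1.trans one_le_two)
  let U₁ : GaugeField (F.P 1) 0 (SU N) := fun bd => if bd.src = p.src.shift p.ν ∧ bd.dir = p.μ then h else 1
  have hU₁le : ∀ q : Plaq (F.P 1) 0, dist1 (GaugeField.plaqHol U₁ q) ≤ t := fun q => by
    rw [← hh]; exact dist1_plaqHol_single_le (p.src.shift p.ν) hp5 h q
  have hU₁p : GaugeField.plaqHol U₁ p = h⁻¹ := plaqHol_single_corner p h
  -- the datum: ALL averages of `U₁`
  let W : MSField (F.P 1) (SU N) := avgFamily (avOfRecord F N 1) U₁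
  have hW0 : W 0 = U₁ := rfl
  -- thresholds `δ₀ := min(δ₁, t/(2b))`, `δ₁`
  set δ₀ : ℝ := min δ₁ (t / (2 * b)) with hδ₀
  have hδ₀pos : 0 < δ₀ := lt_min hδ₁pos (div_pos ht0 (mul_pos two_pos hb0))
  have hδ₀δ₁ : δ₀ ≤ δ₁ := min_le_left _ _
  have hBδ₀ : B₃ * δ₀ ≤ t / 2 :=
    calc B₃ * δ₀ ≤ b * δ₀ := mul_le_mul_of_nonneg_right hbB hδ₀pos.le
      _ ≤ b * (t / (2 * b)) := mul_le_mul_of_nonneg_left (min_le_right _ _) hb0.le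
      _ = t / 2 := by field_simp
  let δ : ℕ → ℝ := fun n => if n = 0 then δ₀ else δ₁
  have hδ0 : δ 0 = δ₀ := rfl
  have hδ1 : δ 1 = δ₁ := rfl
  -- the class membership of `U₁` and its action
  have hU₁class : ∀ n, n ≤ 1 → PlaqSmallOn (omegaPlaqs s.Ω n) (ε₀ * (F.P 1).eta n ^ 2) U₁ := by
    intro n hn q _
    exact (hU₁le q).trans_lt (hte1.trans_le (mul_le_mul_of_nonneg_left (eta_sq_le_eta_sq_of_le hn) hε₀pos.le))
  have hact : 2 * N * wilsonAction4 U₁ < e₁ ^ 2 := by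
    have hA := wilsonAction4_le_card_mul_sq hU₁le
    have hN0 : (0 : ℝ) ≤ 2 * N := by positivity
    have h1 : 2 * N * wilsonAction4 U₁ ≤ 2 * N * cP * t ^ 2 :=
      calc 2 * N * wilsonAction4 U₁ = (2 * N) * wilsonAction4 U₁ := by ring
        _ ≤ (2 * N) * (cP * t ^ 2) := mul_le_mul_of_nonneg_left hA hN0
        _ = 2 * N * cP * t ^ 2 := by ring
    have h2 : 2 * N * cP < Mb := by rw [hMb]; linarith
    have h3 : 2 * N * cP * t ^ 2 < Mb * t ^ 2 := mul_lt_mul_of_pos_right h2 (pow_pos ht0 2)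
    have h4 : Mb * t ≤ e₁ := by linarith [he₁pos]
    have h5 : Mb * t ^ 2 ≤ e₁ * t :=
      calc Mb * t ^ 2 = (Mb * t) * t := by ring
        _ ≤ e₁ * t := mul_le_mul_of_nonneg_right h4 ht0.le
    have h6 : e₁ * t ≤ e₁ * e₁ := mul_le_mul_of_nonneg_left hte1.le he₁pos.le
    calc 2 * N * wilsonAction4 U₁ ≤ 2 * N * cP * t ^ 2 := h1
      _ < Mb * t ^ 2 := h3
      _ ≤ e₁ * t := h5
      _ ≤ e₁ * e₁ := h6
      _ = e₁ ^ 2 := by ring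
  -- EXISTENCE of an open-class minimiser (§1)
  have hex := exists_isMinimizer_holes_of_smallAction F 1 1 s.Ω hα₀pos hα3 hα2 hε₀pos.le hεα (W := W) (U₁ := U₁) hU₁class
    (fun _ _ _ => rfl) hact
  -- the separated-ness, the numerics
  have hsep : Sect2.SeqSeparated ν.M₁ s := fun n h1 hn => by omega
  have hnum : ∀ n, n ≤ 1 → 0 < δ n ∧ δ n ≤ a₁ ∧ B₃ * δ n ≤ ε₀ := by
    intro n hn
    rcases Nat.le_one_iff_eq_zero_or_eq_one.mp hn with rfl | rfl
    · refine ⟨hδ₀pos, hδ₀δ₁.trans hδ₁a, ?_⟩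
      calc B₃ * δ 0 = B₃ * δ₀ := rfl
        _ ≤ b * δ₀ := mul_le_mul_of_nonneg_right hbB hδ₀pos.le
        _ ≤ b * δ₁ := mul_le_mul_of_nonneg_left hδ₀δ₁ hb0.le
        _ ≤ b * (ε₀ / b) := mul_le_mul_of_nonneg_left (min_le_right _ _) hb0.le
        _ = ε₀ := by field_simp
    · exact ⟨hδ₁pos, hδ₁a, hBδ₁⟩
  have hcomp : ∀ n, n < 1 → δ n ≤ 2 * δ (n + 1) := by
    intro n hn
    obtain rfl : n = 0 := by omega
    show δ₀ ≤ 2 * δ₁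
    linarith
  -- the TYPED (7) holds: level 0 is blind to the twisted bond, level 1 reads the coarse plaquettes of `Ū₁`
  have h7 : Sect2.DataSmall7 (avOfRecord F N 1) s.Ω 1 δ W := by
    refine ⟨fun q hq => ?_, fun m hm q _ => ?_⟩
    · -- level 0: `plaqInside Γ₀`, `Γ₀ = Dᶜ`
      have hq' : q ∈ plaqInside Dᶜ := by
        have : genSet s.Ω 1 0 = Dᶜ := by
          show pts 0 (gammaRegion s.Ω 1 0) = Dᶜ
          rw [gammaRegion_zero s.Ω one_pos, pts_zero, hsΩ]
        rwa [this] at hq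
      rw [hW0, plaqHol_single_eq_one_of_plaqInside_compl hxD h hq', GaugeGroup.dist1_one]
      exact hδ₀pos
    · -- level 1: the mixed field of the averaged family is `Ū₁`, whose plaquettes are `< C·2t ≤ δ₁`
      obtain rfl : m = 0 := by omega
      have hmix : Sect2.mixedField (avOfRecord F N 1) (genSet s.Ω 1 (0 + 1)) (W (0 + 1)) (W 0) = avgFun expMeanLogSU U₁ := by
        rw [hW0, show W (0 + 1) = (avOfRecord F N 1 0).avg U₁ from rfl, mixedField_avg_self, avOfRecord_avg]
      rw [hmix]
      have h2t : PlaqSmall (2 * t) U₁ := fun q' => (hU₁le q').trans_lt (by linarith)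
      have hguard : ((((F.P 1).d + 2) * (F.P 1).L : ℕ) : ℝ) ^ 2 / 4 * (2 * t) < deltaSU (Fin N) := by
        have : ((((F.P 1).d + 2) * (F.P 1).L : ℕ) : ℝ) ^ 2 / 4 * (2 * t) = 18 * ((F.P 1).L : ℝ) ^ 2 * t := by
          rw [hd]; push_cast; ring
        rw [this]
        have h := (le_div_iff₀ (by linarith : (0 : ℝ) < 36 * ((F.P 1).L : ℝ) ^ 2 + 1)).mp htS
        have hL2t : 0 ≤ ((F.P 1).L : ℝ) ^ 2 * t := mul_nonneg hL2pos.le ht0.le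
        have h' : t * (36 * ((F.P 1).L : ℝ) ^ 2 + 1) = 36 * (((F.P 1).L : ℝ) ^ 2 * t) + t := by ring
        have h'' : 18 * ((F.P 1).L : ℝ) ^ 2 * t = 18 * (((F.P 1).L : ℝ) ^ 2 * t) := by ring
        rw [h'']; rw [h'] at h; linarith
      have hlt := dist1_plaqHol_avgFun_lt (n := Fin N) hK (by linarith : (0 : ℝ) ≤ 2 * t) h2t hguard q
      exact hlt.trans_le (hCt.trans (le_of_eq hδ1.symm))
  -- the violation at the pinned corner plaquette, for EVERY minimiser
  have hviol : ∀ U₀, IsMinimizer (avOfRecord F N 1)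
      {U | ∀ n, n ≤ 1 → PlaqSmallOn (omegaPlaqs s.Ω n) (ε₀ * (F.P 1).eta n ^ 2) U} (genSet s.Ω 1) W U₀ →
      B₃ * δ 0 * (F.P 1).eta 0 ^ 2 ≤ dist1 (GaugeField.plaqHol U₀ p) := by
    intro U₀ hU₀
    have hpin := plaqHol_eq_of_agreeOn (avOfRecord F N 1) one_pos s.Ω hU₀.2.1 p (hsΩ ▸ hp2) (hsΩ ▸ hp3) (hsΩ ▸ hp4)
    rw [hpin, hW0, hU₁p, GaugeGroup.dist1_inv, hh]
    have hη0 : (F.P 1).eta 0 ^ 2 = 1 := by simp [Params.eta]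
    rw [hη0, mul_one, hδ0]
    linarith
  refine ⟨ν, 1, fun _ => 1, s, ε₀, δ, W, p, hsep, hnum, hcomp, hε₀a₀, h7, h7.toOuter (outerPlaqs_zero_subset_plaqInside s.Ω one_pos),
    hex, ?_, hviol⟩
  rw [omegaPlaqs_zero]; exact Set.mem_univ p

/-- ★★★ **THE RE-TYPED FACT OF RECORD IS UNINHABITED AT EVERY `B₃`**: for all `a₀, a₁ > 0` and every `B₃`, `¬ VariationalThm1RegSepMixed F N B₃ a₀ a₁` on any
`SU(N)` on which `dist1` is onto `[0, 2]` — the (R) sentence at scale `0` fails at the data-pinned corner plaquette, for a datum the typed (7) admits at every `δ₀`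
and a minimiser that EXISTS (§1).  The typed level-0 range `plaqInside Γ₀`, not print's (7), is what fails.
[cite: Balaban1985Variational, Thm 1 (7)–(8) pp.278–279; Balaban1988Convergent, (2.10)–(2.12) p.256] -/
theorem not_variationalThm1RegSepMixed_of_dist1Surj (hG : ∀ t : ℝ, 0 ≤ t → t ≤ 2 → ∃ g : SU N, dist1 g = t) {B₃ a₀ a₁ : ℝ}
    (ha₀ : 0 < a₀) (ha₁ : 0 < a₁) : ¬ VariationalThm1RegSepMixed F N B₃ a₀ a₁ := by
  intro h15
  obtain ⟨ν, M, g, s, ε₀, δ, W, p, hsep, hnum, hcomp, hε₀, h7, -, ⟨U₀, hU₀⟩, hp, hviol⟩ :=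
    exists_cornerLevelZero_instance F hG B₃ ha₀ ha₁
  have h := h15 ν M g 1 1 s hsep ε₀ δ hnum hcomp hε₀ W h7 U₀ hU₀ 0 (Nat.zero_le _) p hp
  exact absurd h (not_lt.mpr (hviol U₀ hU₀))

/-- ★★★ **THE v1.2 «OUTER-RANGE» FACT IS UNINHABITED AT EVERY `B₃` TOO**: `¬ VariationalThm1RegSepOuter F N B₃ a₀ a₁` (`0 < a₀`, `0 < a₁`, `dist1` onto `[0, 2]`) — at level 0
its range `Sect2.outerPlaqs s.Ω k 0` is `plaqInside Γ₀` again (`outerPlaqs_zero_subset_plaqInside`), so the same datum, the same minimiser and the same pinned corner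
plaquette refute it. [cite: Balaban1985Variational, Thm 1 (7)–(8) pp.278–279; Balaban1988Convergent, (2.10)–(2.12) p.256] -/
theorem not_variationalThm1RegSepOuter_of_dist1Surj (hG : ∀ t : ℝ, 0 ≤ t → t ≤ 2 → ∃ g : SU N, dist1 g = t) {B₃ a₀ a₁ : ℝ}
    (ha₀ : 0 < a₀) (ha₁ : 0 < a₁) : ¬ VariationalThm1RegSepOuter F N B₃ a₀ a₁ := by
  intro h15
  obtain ⟨ν, M, g, s, ε₀, δ, W, p, hsep, hnum, hcomp, hε₀, -, h7, ⟨U₀, hU₀⟩, hp, hviol⟩ :=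
    exists_cornerLevelZero_instance F hG B₃ ha₀ ha₁
  have h := h15 ν M g 1 1 s hsep ε₀ δ hnum hcomp hε₀ W h7 U₀ hU₀ 0 (Nat.zero_le _) p hp
  exact absurd h (not_lt.mpr (hviol U₀ hU₀))

/-- ★★★ **`SU(2)`: `¬ VariationalThm1RegSepMixed F 2 B₃ a₀ a₁` FOR EVERY `B₃`** (`0 < a₀`, `0 < a₁`; `dist1` is onto `[0, 2]` on `SU(2)`, 17a `su2_dist1_surj`) —
a supplier keyed on `h15 : VariationalThm1RegSepMixed F 2 …` has jointly unsatisfiable binders.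
[cite: Balaban1985Variational, Thm 1 (7)–(8) pp.278–279] -/
theorem not_variationalThm1RegSepMixed {B₃ a₀ a₁ : ℝ} (ha₀ : 0 < a₀) (ha₁ : 0 < a₁) : ¬ VariationalThm1RegSepMixed F 2 B₃ a₀ a₁ :=
  not_variationalThm1RegSepMixed_of_dist1Surj F su2_dist1_surj ha₀ ha₁

/-- ★★★ **`SU(2)`: `¬ VariationalThm1RegSepOuter F 2 B₃ a₀ a₁` FOR EVERY `B₃`** (`0 < a₀`, `0 < a₁`) — a supplier keyed on `h15 : VariationalThm1RegSepOuter F 2 …`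
(FILE 8 v1.2 `plaqSmallOn_UbgMSOfRecord_of_thm1RegSepOuter`, `bgRowAtDatum_of_thm1RegSepOuterC1`) has jointly unsatisfiable binders.
[cite: Balaban1985Variational, Thm 1 (7)–(8) pp.278–279] -/
theorem not_variationalThm1RegSepOuter {B₃ a₀ a₁ : ℝ} (ha₀ : 0 < a₀) (ha₁ : 0 < a₁) : ¬ VariationalThm1RegSepOuter F 2 B₃ a₀ a₁ :=
  not_variationalThm1RegSepOuter_of_dist1Surj F su2_dist1_surj ha₀ ha₁

/-- Contrapositive packaging: if the re-typed fact holds at `SU(2)` for some `(B₃, a₀, a₁)` then `a₀ ≤ 0 ∨ a₁ ≤ 0` (its threshold binders are then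
unsatisfiable — the fact is VACUOUS). [cite: Balaban1985Variational, Thm 1 (7)–(8) pp.278–279 (bookkeeping)] -/
theorem variationalThm1RegSepMixed_only_degenerate {B₃ a₀ a₁ : ℝ} (h : VariationalThm1RegSepMixed F 2 B₃ a₀ a₁) : a₀ ≤ 0 ∨ a₁ ≤ 0 := by
  by_contra hc
  simp only [not_or, not_le] at hc
  exact not_variationalThm1RegSepMixed F hc.1 hc.2 h

end Refutation

end Summit.QuantumFields.YangMills.BalabanUVNodes.N07Thm1CornerLevelZeroObstruction

end
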